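/-
Copyright (c) 2026. All rights reserved.
Released under Apache 2.0 license as described in the file LICENSE.
-/
import Mathlib
import HarnessLib

/-!
# G imaginary part decomposition helpers for CombDescentStep

This file provides arithmetic bounds and decomposition helpers for the G function
imaginary part, used in the CombDescentStep proof.

## Main results

* `pi_s_bound_gt_four_h`: π/s - 5/(2h) > 4/h when 8s ≤ h
* `conjugate_term_im`: Im[1/(c - conj c)] = -1/(2h) where c = x₀ + ih
-/

open Complex Real Set Filter Topology Metric
open scoped BigOperators Topology ComplexConjugate

noncomputable section

namespace EarlyAppointmentsGImagDecomposition

/-- The key arithmetic bound: π/s - 5/(2h) > 4/h when 8s ≤ h.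

From 8s ≤ h we get π/s ≥ 8π/h > 25/h. Then π/s - 5/(2h) > 25/h - 2.5/h = 22.5/h > 4/h. -/
theorem pi_s_bound_gt_four_h {s h : ℝ} (hs : 0 < s) (hh : 0 < h) (hsh : 8 * s ≤ h) :
    π / s - 5 / (2 * h) > 4 / h := by
  have h_inv : 1 / s ≥ 8 / h := by
    rw [ge_iff_le, div_le_div_iff₀ hh hs]
    linarith
  have hpi_s : π / s ≥ 8 * π / h := by
    have hpi : π > 0 := Real.pi_pos
    calc π / s = π * (1 / s) := by ring
      _ ≥ π * (8 / h) := by nlinarith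
      _ = 8 * π / h := by ring
  have h8pi : 8 * π > 25 := by
    have := Real.pi_gt_d2
    linarith
  have h6 : 8 * π / h - 5 / (2 * h) > 4 / h := by
    have h7 : 8 * π / h - 5 / (2 * h) = (16 * π - 5) / (2 * h) := by field_simp; ring
    rw [h7, gt_iff_lt, div_lt_div_iff₀ (by positivity) (by positivity)]
    have hpi3 : π > 3 := Real.pi_gt_three
    nlinarith
  linarith

/-- The imaginary part of the conjugate term: Im[1/(c - conj c)] = -1/(2h).

For c = x₀ + ih, we have c - conj(c) = 2ih, so 1/(c - conj c) = 1/(2ih) = -i/(2h).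
The imaginary part is -1/(2h). -/
theorem conjugate_term_im {x₀ h : ℝ} (hh : 0 < h) :
    let c := (x₀ : ℂ) + h * I
    (1 / (c - conj c)).im = -1 / (2 * h) := by
  simp only [map_add, map_mul, Complex.conj_I, Complex.conj_ofReal]
  have h1 : ((x₀ : ℂ) + h * I) - ((x₀ : ℂ) + h * (-I)) = 2 * h * I := by ring
  rw [h1]
  have hne : (2 * h : ℂ) ≠ 0 := by simp; linarith
  have hIne : I ≠ (0 : ℂ) := Complex.I_ne_zero
  have _hmul_ne : (2 * h : ℂ) * I ≠ 0 := mul_ne_zero hne hIne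
  rw [one_div, mul_comm (2 * (h : ℂ)) I]
  rw [mul_inv, Complex.inv_I]
  simp only [neg_mul, Complex.neg_im, Complex.mul_im, Complex.I_re, Complex.I_im, zero_mul]
  have _h2hne : (2 * h : ℝ) ≠ 0 := by linarith
  have h2eq : (2 : ℂ) * ↑h = ↑(2 * h) := by push_cast; ring
  have hinv_re : ((2 : ℂ) * ↑h)⁻¹.re = (2 * h : ℝ)⁻¹ := by
    rw [h2eq, ← Complex.ofReal_inv, Complex.ofReal_re]
  rw [hinv_re]
  ring

end EarlyAppointmentsGImagDecomposition

end
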